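import Summits.HodgeConjecture.HodgeConjecture.Theses.TateCuspKLift
import Summits.HodgeConjecture.HodgeConjecture.Theorems.BoundaryReadoutPullbackAlgebraic
import HarnessLib

/-!
# Crux `KClassPropagates` (stmt-HodgeConjecture-9314), line `birth` — registered stub S2
# `stub_fultonPullback`, CLOSED BY NAME

Route `TateCuspKLift` of `HodgeConjecture`. The registered skeleton `Cruxes/KClassPropagates/Lines/birth.lean`
names as its stub S2, BY NAME, the Literature named fact

  `Literature.AlgebraicGeometry.HodgeTheory.fulton1998_map_mem_algebraicClasses`

(Fulton 1998, Cor. 19.2 (b) / Voisin II Prop. 9.21 (i): pull-back along a `ℂ`-morphism of smooth projective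
varieties preserves `algebraicClasses`). That fact is a THEOREM of the tree since 2026-08-17 17:15Z
(`Theorems.fulton1998_map_mem_algebraicClasses_holds`, `Theorems/BoundaryReadoutPullbackAlgebraic.lean`:
deformation to the normal cone in coniveau form, line `normal_cone` of crux `PullbackAlgebraic`,
stmt-HodgeConjecture-1071 — CLOSED), landed after this skeleton was registered and never credited to the
stub. This file records the stub VERBATIM so that the crux's ledger entry carries the credit; with it the
skeleton's `PBᵖ(X_t) = algebraicClasses X_t p` on smooth projective fibres is unconditional. No mathematics
beyond the citation of the tree theorem.

## References

* [Fulton1998] W. Fulton, Intersection Theory, 2nd ed. (1998), Cor. 19.2 (b).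
* [VoisinHodgeII2003] C. Voisin, Hodge Theory and Complex Algebraic Geometry II (2003), Prop. 9.21 (i).
-/

noncomputable section

-- `Summit.HodgeConjecture.HodgeConjecture.…` is the mandated namespace (single-conjunct summit).
set_option linter.dupNamespace false

namespace Summit.HodgeConjecture.HodgeConjecture.Theorems

/-- **Registered stub `stub_fultonPullback` of the line `birth`** (crux `KClassPropagates`,
stmt-HodgeConjecture-9314), verbatim: for a `ℂ`-morphism `j : X ⟶ Y` of smooth projective complex
varieties, `j^*(algebraicClasses Y p) ⊆ algebraicClasses X p`. Discharged by the tree theorem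
`Theorems.fulton1998_map_mem_algebraicClasses_holds` (crux `PullbackAlgebraic`, deformation to the normal
cone). [cite: Fulton1998, Cor. 19.2 (b)] [cite: VoisinHodgeII2003, Prop. 9.21 (i)] -/
theorem stub_fultonPullback :
    Literature.AlgebraicGeometry.HodgeTheory.fulton1998_map_mem_algebraicClasses :=
  fulton1998_map_mem_algebraicClasses_holds

end Summit.HodgeConjecture.HodgeConjecture.Theorems

end
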